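import Summits.Langlands.Langlands.Theses.DyadicOddResidue

/-!
# `DyadicOddResidue.SectorComplement` (stmt-Langlands-18745) — negative-side position lemmas

Disprover's kernel-checked bookkeeping for the route's declared junction
`SectorComplement := OddRegularReciprocityQ → Langlands` (route DyadicOddResidue, rank 9, "the rest of
the summit along this line", never staffed). Nothing here asserts the item, its negation, the target
or the summit; every conclusion is negative or a truth table:

* `dyadicOddResidue_not_sectorComplement_iff`: `¬ C ↔ X ∧ ¬ Langlands` — a disproof of the junction
  is EXACTLY a proof of the open sector theorem `X = OddRegularReciprocityQ` (odd, Hodge–Tate regular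
  Fontaine–Mazur for `GL₂` over `ℚ` at EVERY prime `ℓ`, including the unprinted dyadic residue
  `ℓ = 2`, solvable residual image) together with a refutation of the formal summit `_root_.Langlands`;
* `dyadicOddResidue_not_langlands_of_not_target`: `¬ X → ¬ Langlands` — the sector is contained in the
  summit AS TYPED (direction (B) `GaloisToAutomorphic` at `n = 2`, `F = ℚ`, reciprocity data from the
  summit's own non-vacuity conjunct `Nonempty (ReciprocityData ℚ)`; the target's pinned de Rham clause
  `(fontainePstAdicCompletion v ℓ hv).IsDeRhamFramed (ρ.toLocal v)` IS `(𝓡.pst ℓ v hv).IsDeRhamFramed …`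
  because `ReciprocityData.pst` is the projection-shaped definition returning the pinned datum; oddness
  and Hodge–Tate regularity are simply unused; `Corresponds` contains the target's a.e.
  Satake–Frobenius clause verbatim), so a counterexample to Fontaine–Mazur in the sector would refute
  `Langlands` itself and would PROVE the junction (ex falso), never refute it;
* `dyadicOddResidue_not_target_iff_sectors`: `¬ X ↔ ¬ K1 ∨ ¬ K2 ∨ ¬ S1 ∨ ¬ S2` — the route's
  trichotomy (`ℓ = 2`?, residually absolutely irreducible?, solvable residual image?) is a PARTITION of
  the target: a counterexample to the target lives in exactly the four declared sectors
  (`DyadicEisensteinFM`, `DyadicDihedralFM`, `OddPrimesRegularFM`, `DyadicNonsolvableFM`) and each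
  sector is a restriction of the target, so none of the four is stronger than the summit either;
* `dyadicOddResidue_sectorComplement_iff_not_or`: truth table `C ↔ ¬ X ∨ Langlands` — provable only
  by proving the summit or refuting the target, refutable only in the world "target true, summit
  false".

Work file with the full analysis: `Cruxes/SectorComplement/Disproof.lean` (§ DyadicOddResidue).
-/

set_option linter.dupNamespace false -- project-wide option; `Summit.Langlands.Langlands` is the mandated namespace

namespace Summit.Langlands.Langlands.Theorems

open Summit.Langlands.Langlands.Theses.DyadicOddResidue

/-- Exact content of a refutation of the junction: `¬ SectorComplement ↔ OddRegularReciprocityQ ∧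
¬ Langlands` — prove the open sector theorem AND disprove the formal summit. [folklore] -/
theorem dyadicOddResidue_not_sectorComplement_iff :
    ¬ SectorComplement ↔ OddRegularReciprocityQ ∧ ¬ _root_.Langlands :=
  Classical.not_imp

/-- **A counterexample to the sector theorem refutes the summit as typed**: `¬ X → ¬ Langlands`.
Contrapositive of the containment `Langlands → OddRegularReciprocityQ`: direction (B) of the summit
at `n = 2`, `F = ℚ`, for the reciprocity data `𝓡` given by the summit's conjunct
`Nonempty (ReciprocityData ℚ)`; the target's hypothesis "de Rham at `v ∣ ℓ` for Fontaine's pinned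
datum `fontainePstAdicCompletion v ℓ hv`" is literally "de Rham for `𝓡.pst ℓ v hv`"
(`ReciprocityData.pst` is by definition the pinned datum), and `Corresponds` contains the target's
a.e. Satake–Frobenius clause verbatim; `IsOdd` and the `Nodup` (regularity) clause are not used.
[folklore] -/
theorem dyadicOddResidue_not_langlands_of_not_target
    (hX : ¬ OddRegularReciprocityQ) : ¬ _root_.Langlands := by
  intro hL
  apply hX
  intro ℓ _ ρ hirr _hodd hur hdR hcpt ι
  obtain ⟨⟨𝓡⟩, h⟩ := hL ℚ
  have hB : Summit.Langlands.GaloisToAutomorphic 2 𝓡 hcpt := (h 𝓡 2 two_pos hcpt).2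
  have hgeo : Summit.Langlands.IsGeometricFramed 𝓡 ρ := ⟨hur, fun v hv ↦ (hdR v hv).1⟩
  obtain ⟨π, hLalg, hcorr⟩ := hB ℓ ι ρ hirr hgeo
  exact ⟨π, hLalg, hcorr.1⟩

/-- **Where a counterexample to the target can live**: the route's trichotomy is a partition —
`¬ X ↔ ¬ DyadicEisensteinFM ∨ ¬ DyadicDihedralFM ∨ ¬ OddPrimesRegularFM ∨ ¬ DyadicNonsolvableFM`.
(`→`: the case split of the deciding theorem `closes` read contrapositively; `←`: each sector
statement is the target restricted to its sector.) [folklore] -/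
theorem dyadicOddResidue_not_target_iff_sectors :
    ¬ OddRegularReciprocityQ ↔
      ¬ DyadicEisensteinFM ∨ ¬ DyadicDihedralFM ∨ ¬ OddPrimesRegularFM ∨ ¬ DyadicNonsolvableFM := by
  constructor
  · intro hX
    by_contra hcon
    simp only [not_or, not_not] at hcon
    obtain ⟨h₁, h₂, h₃, h₄⟩ := hcon
    apply hX
    intro ℓ _ ρ hirr hodd hunr hdR hcpt ι
    by_cases hℓ : ℓ = 2
    · by_cases hres : ρ.IsResiduallyAbsIrreducible
      · by_cases hsol : IsSolvable ρ.residualRep.range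
        · exact h₂ ℓ hℓ ρ hres hsol hirr hodd hunr hdR hcpt ι
        · exact h₄ ℓ hℓ ρ hres hsol hirr hodd hunr hdR hcpt ι
      · exact h₁ ℓ hℓ ρ hres hirr hodd hunr hdR hcpt ι
    · exact h₃ ℓ hℓ ρ hirr hodd hunr hdR hcpt ι
  · rintro (h | h | h | h) hX <;> apply h
    · intro ℓ _ _ ρ _ hirr hodd hunr hdR hcpt ι
      exact hX ℓ ρ hirr hodd hunr hdR hcpt ι
    · intro ℓ _ _ ρ _ _ hirr hodd hunr hdR hcpt ι
      exact hX ℓ ρ hirr hodd hunr hdR hcpt ι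
    · intro ℓ _ _ ρ hirr hodd hunr hdR hcpt ι
      exact hX ℓ ρ hirr hodd hunr hdR hcpt ι
    · intro ℓ _ _ ρ _ _ hirr hodd hunr hdR hcpt ι
      exact hX ℓ ρ hirr hodd hunr hdR hcpt ι

/-- Hence a counterexample in ANY of the four sectors — in particular in the two live dyadic cruxes
`DyadicEisensteinFM` / `DyadicDihedralFM` — refutes the formal summit (and proves the junction ex
falso): the cruxes are inside the summit as typed, with no typing drift to exploit. [folklore] -/
theorem dyadicOddResidue_not_langlands_of_not_sector
    (h : ¬ DyadicEisensteinFM ∨ ¬ DyadicDihedralFM ∨ ¬ OddPrimesRegularFM ∨ ¬ DyadicNonsolvableFM) :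
    ¬ _root_.Langlands :=
  dyadicOddResidue_not_langlands_of_not_target (dyadicOddResidue_not_target_iff_sectors.2 h)

/-- Truth table of the junction: `SectorComplement ↔ ¬ OddRegularReciprocityQ ∨ Langlands` —
provable only by proving the summit or refuting the target, refutable only in the world "target
true, summit false". [folklore] -/
theorem dyadicOddResidue_sectorComplement_iff_not_or :
    SectorComplement ↔ ¬ OddRegularReciprocityQ ∨ _root_.Langlands :=
  imp_iff_not_or

end Summit.Langlands.Langlands.Theorems
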